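import Summits.AtomisticToContinuum.FouriersLaw.Theorems.HonestZwanzigFeshbachIdentitiesResolventB
import Summits.AtomisticToContinuum.FouriersLaw.Theorems.HonestZwanzigFeshbachIdentitiesCorrelations
import Summits.AtomisticToContinuum.FouriersLaw.Theorems.PhononMeanFreePathIncoherentBoundedFixedN

/-!
# `PhononMeanFreePath.IncoherentBounded` — Green–Kubo integrals of equilibrium autocorrelations are non-negative

Helper file for item `stmt-AtomisticToContinuum-11815` (support `IncoherentBounded`, route `PhononMeanFreePath`,
sub-problem `FouriersLaw`). For the pinned anharmonic chain `pinnedChain ω₂ lam β γ` (`ω₂, β, γ > 0`, `lam ≥ 0`) with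
`N ≥ 1` sites and both baths at `T > 0` (`μ_T = gibbsMeasure N T`, `P_t = transitionKernel N T T t`, both CONSTRUCTED) and
a NICE observable `v` (continuous, `|v| ≤ C e^{ϑH}`, `0 < ϑ`, `2ϑ < 1/T`):

* `integral_Ioi_nonneg_of_laplace_nonneg` — real analysis: `φ ∈ L¹(0,∞)` with all Laplace transforms
  `∫ e^{-st} φ ≥ 0` (`s > 0`) has `∫₀^∞ φ ≥ 0` (Abel limit `s → 0⁺`, dominated convergence);
* `laplace_autocorr_nonneg` — `0 ≤ ∫_{t>0} e^{-st} ⟨v, P_t v⟩_{μ_T} dt` for `s > 0`: by Fubini this is `⟨v, R_s v⟩_{μ_T}`,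
  which dominates `s ‖R_s v‖²_{L²(μ_T)} ≥ 0` by the resolvent inequality of the equilibrium semigroup
  (`HonestZwanzig.pinnedChain_integral_mul_resolvent_ge`, the semigroup form of `Re⟨(s - L)w, w⟩ ≥ s‖w‖²`);
* `greenKubo_autocorr_nonneg` — **for a centred nice `v` (`∫ v dμ_T = 0`), `0 ≤ ∫_{t>0} ⟨v, P_t v⟩_{μ_T} dt`**
  (the autocorrelation is in `L¹(0,∞)` by the fixed-`N` exponential mixing, so the Abel limit applies).

This is the positivity of the symmetric part of `(-L)⁻¹` on `L²(μ_T) ⊖ 1`, obtained without generator theory. The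
application to the near kinetic kernel of the item (`v = p₀² - T`: `∫₀^∞ A_N ≥ 0`, hence by the sum rule the `N`-uniform
conductance bound `(γ²/T²) ∫₀^∞ C_N ≤ γ/2` and `a_N ≤ γN/2`) is the file `…IncoherentBoundedContactBound`.
No definitions; nothing here closes an item.
-/

noncomputable section

open MeasureTheory ProbabilityTheory Filter Topology Set
open scoped NNReal ENNReal
open Literature.MathematicalPhysics.KineticTheory.HeatConduction
open Literature.MathematicalPhysics.KineticTheory Literature.Probability.Process OscillatorChain
open Summit.AtomisticToContinuum.FouriersLaw.Theorems.SubdiffusiveBondHeat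
open Summit.AtomisticToContinuum.FouriersLaw.Theorems.OddSectorIrreversibility
open Summit.AtomisticToContinuum.FouriersLaw.Theorems.HonestZwanzig

namespace Summit.AtomisticToContinuum.FouriersLaw.Theorems.IncoherentBounded

/-! ## 1. The Abel limit `s → 0⁺` of Laplace transforms -/

/-- **Abel/Laplace limit**: for `φ ∈ L¹(0,∞)`, `∫_{t>0} e^{-st} φ(t) dt → ∫_{t>0} φ` as `s → 0⁺` (dominated convergence,
`|e^{-st} φ| ≤ |φ|`). [folklore] -/
theorem tendsto_laplace_nhdsWithin_zero {φ : ℝ → ℝ} (hφ : IntegrableOn φ (Ioi 0)) :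
    Tendsto (fun s : ℝ => ∫ t in Ioi (0 : ℝ), Real.exp (-(s * t)) * φ t) (𝓝[>] 0)
      (𝓝 (∫ t in Ioi (0 : ℝ), φ t)) := by
  have h1 : (∫ t in Ioi (0 : ℝ), φ t) = ∫ t in Ioi (0 : ℝ), Real.exp (-(0 * t)) * φ t := by
    simp
  rw [h1]
  refine tendsto_integral_filter_of_dominated_convergence (fun t => ‖φ t‖) ?_ ?_ hφ.norm ?_
  · refine Eventually.of_forall fun s => ?_
    exact ((Real.continuous_exp.comp (continuous_const.mul continuous_id).neg).aestronglyMeasurable).mul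
      hφ.aestronglyMeasurable
  · refine eventually_nhdsWithin_of_forall fun s (hs : 0 < s) => ?_
    refine (ae_restrict_iff' measurableSet_Ioi).2 (Eventually.of_forall fun t (ht : 0 < t) => ?_)
    rw [norm_mul, Real.norm_eq_abs, abs_of_pos (Real.exp_pos _)]
    have : Real.exp (-(s * t)) ≤ 1 := Real.exp_le_one_iff.2 (by nlinarith)
    exact mul_le_of_le_one_left (norm_nonneg _) this
  · refine Eventually.of_forall fun t => ?_
    refine ((Real.continuous_exp.comp ?_).tendsto' 0 _ ?_).mul tendsto_const_nhds |>.mono_left nhdsWithin_le_nhds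
    · exact (continuous_id.mul continuous_const).neg
    · simp

/-- If `φ ∈ L¹(0,∞)` and all its Laplace transforms are non-negative, `∫_{t>0} e^{-st} φ ≥ 0` for `s > 0`, then
`∫_{t>0} φ ≥ 0`. [folklore] -/
theorem integral_Ioi_nonneg_of_laplace_nonneg {φ : ℝ → ℝ} (hφ : IntegrableOn φ (Ioi 0))
    (h : ∀ s : ℝ, 0 < s → 0 ≤ ∫ t in Ioi (0 : ℝ), Real.exp (-(s * t)) * φ t) :
    0 ≤ ∫ t in Ioi (0 : ℝ), φ t :=
  ge_of_tendsto (tendsto_laplace_nhdsWithin_zero hφ) (eventually_nhdsWithin_of_forall h)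

/-! ## 2. Positivity of the Laplace transform of an equilibrium autocorrelation -/

section Pinned

variable {ω₂ lam β γ : ℝ} (hω : 0 < ω₂) (hl : 0 ≤ lam) (hβ : 0 < β) (hγ : 0 < γ) {N : ℕ} (hN : 0 < N)
  {T : ℝ} (hT : 0 < T)
include hω hl hβ hγ hN hT

/-- **`0 ≤ ∫_{t>0} e^{-st} ⟨v, P_t v⟩_{μ_T} dt`** for a nice observable `v` and `s > 0`: the left side is `⟨v, R_s v⟩_{μ_T}`
(Fubini), which is `≥ s ∫ (R_s v)² dμ_T ≥ 0` by the resolvent inequality of the equilibrium semigroup.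
[cite: CuneoEckmannHairerReyBellet2018, Thm 2.13] -/
theorem laplace_autocorr_nonneg {ϑ : ℝ} (hϑ0 : 0 < ϑ) (h2ϑ : 2 * ϑ < 1 / T)
    {v : PhaseSpace N → ℝ} (hv : Continuous v) {Cv : ℝ} (hCv : 0 ≤ Cv)
    (hvb : ∀ y, |v y| ≤ Cv * Real.exp (ϑ * (pinnedChain ω₂ lam β γ).hamiltonian N y)) {s : ℝ} (hs : 0 < s) :
    0 ≤ ∫ t in Ioi (0 : ℝ), Real.exp (-(s * t)) * ∫ z, v z *
        (∫ y, v y ∂((pinnedChain ω₂ lam β γ).transitionKernel N T T t.toNNReal z)) ∂((pinnedChain ω₂ lam β γ).gibbsMeasure N T) := by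
  have hϑ1 : ϑ < 1 / T := by linarith
  have h2ϑ0 : 0 < 2 * ϑ := by positivity
  set P := pinnedChain ω₂ lam β γ with hP
  set μ := P.gibbsMeasure N T with hμ
  haveI : IsProbabilityMeasure μ := pinnedChain_isProbabilityMeasure_gibbsMeasure hω hl hβ.le γ N hT
  obtain ⟨K, c, -, hc, hb⟩ := pinnedChain_harris_bound hω hl hβ hγ hN hT hϑ0 hϑ1
  have hE2 : Integrable (fun y => Real.exp (2 * ϑ * P.hamiltonian N y)) μ :=
    pinnedChain_integrable_exp_mul_hamiltonian_gibbsMeasure hω hl hβ.le γ N hT h2ϑ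
  have hv2 : Integrable (fun z => v z ^ 2) μ := pinnedChain_integrable_sq_nice hω hl hβ hT h2ϑ hv hvb
  have hexp : IntegrableOn (fun t : ℝ => Real.exp (-(s * t))) (Ioi 0) := by
    have := exp_neg_integrableOn_Ioi 0 hs
    refine this.congr_fun (fun t _ => by ring_nf) measurableSet_Ioi
  have hF := pinnedChain_integral_mul_setIntegral_exp_act hω hl hβ hγ hϑ0 hb hc hv hCv hvb μ hE2
    hv.stronglyMeasurable hv2 hexp
  rw [← hF]
  have hge := pinnedChain_integral_mul_resolvent_ge hω hl hβ hγ hN hT hϑ0 h2ϑ hv hCv hvb hs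
  have h0 : 0 ≤ s * ∫ z, (∫ t in Ioi (0 : ℝ), Real.exp (-(s * t)) *
      ∫ y, v y ∂(P.transitionKernel N T T t.toNNReal z)) ^ 2 ∂μ :=
    mul_nonneg hs.le (integral_nonneg fun z => sq_nonneg _)
  exact h0.trans hge

/-- **GREEN–KUBO POSITIVITY.** For a CENTRED nice observable `v` (`∫ v dμ_T = 0`; continuous, `|v| ≤ C e^{ϑH}`, `0 < ϑ`,
`2ϑ < 1/T`) of the pinned anharmonic chain at equilibrium: the time-integrated autocorrelation is non-negative,

  `0 ≤ ∫_{t>0} ⟨v, P_t v⟩_{μ_T} dt`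

(the autocorrelation is in `L¹(0,∞)` by exponential mixing at fixed `N`; all its Laplace transforms are `≥ 0` by
`laplace_autocorr_nonneg`; Abel limit). This is the positivity of the symmetric part of `(-L)⁻¹` on mean-zero observables,
for the non-reversible (hypoelliptic) Langevin dynamics. [cite: CuneoEckmannHairerReyBellet2018, Thm 2.13] -/
theorem greenKubo_autocorr_nonneg {ϑ : ℝ} (hϑ0 : 0 < ϑ) (h2ϑ : 2 * ϑ < 1 / T)
    {v : PhaseSpace N → ℝ} (hv : Continuous v) {Cv : ℝ} (hCv : 0 ≤ Cv)
    (hvb : ∀ y, |v y| ≤ Cv * Real.exp (ϑ * (pinnedChain ω₂ lam β γ).hamiltonian N y))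
    (hv0 : ∫ z, v z ∂((pinnedChain ω₂ lam β γ).gibbsMeasure N T) = 0) :
    0 ≤ ∫ t in Ioi (0 : ℝ), ∫ z, v z *
        (∫ y, v y ∂((pinnedChain ω₂ lam β γ).transitionKernel N T T t.toNNReal z)) ∂((pinnedChain ω₂ lam β γ).gibbsMeasure N T) := by
  have hI := pinnedChain_integrableOn_corr_nice hω hl hβ hγ hN hT hϑ0 h2ϑ hv hv hCv hCv hvb hvb
  simp only [hv0, mul_zero, sub_zero] at hI
  exact integral_Ioi_nonneg_of_laplace_nonneg hI fun s hs => laplace_autocorr_nonneg hω hl hβ hγ hN hT hϑ0 h2ϑ hv hCv hvb hs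

/-- **The near kinetic kernel has a non-negative Green–Kubo integral**: with `θ_i = p_i² - T` (a centred nice observable,
`|θ_i| ≤ (16T + T) e^{H/(8T)}`, `∫ θ_i dμ_T = T - T = 0`), `0 ≤ ∫_{t>0} ∫ θ_i · P_t θ_i dμ_T dt` for every site `i` and
every size `N ≥ 1`. [cite: CuneoEckmannHairerReyBellet2018, Thm 2.13] -/
theorem integral_kinCorr_self_nonneg (i : Fin N) :
    0 ≤ ∫ t in Ioi (0 : ℝ), ∫ z, (z.2 i ^ 2 - T) * (∫ y, (y.2 i ^ 2 - T)
        ∂((pinnedChain ω₂ lam β γ).transitionKernel N T T t.toNNReal z)) ∂((pinnedChain ω₂ lam β γ).gibbsMeasure N T) := by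
  have hϑ0 : (0 : ℝ) < 1 / (8 * T) := by positivity
  have h2ϑ : 2 * (1 / (8 * T)) < 1 / T := by
    rw [show 2 * (1 / (8 * T)) = 1 / (4 * T) by field_simp; ring, div_lt_div_iff₀ (by positivity) hT]; nlinarith
  have hvb : ∀ y : PhaseSpace N, |y.2 i ^ 2 - T| ≤ (2 / (1 / (8 * T)) + T) *
      Real.exp (1 / (8 * T) * (pinnedChain ω₂ lam β γ).hamiltonian N y) := fun y =>
    abs_sq_momentum_sub_le_exp hω hl hβ.le hϑ0 hT.le y i
  have hv0 : ∫ z, (z.2 i ^ 2 - T) ∂((pinnedChain ω₂ lam β γ).gibbsMeasure N T) = 0 := by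
    haveI := pinnedChain_isProbabilityMeasure_gibbsMeasure hω hl hβ.le γ N hT
    have hϑ1 : 1 / (8 * T) < 1 / T := by linarith
    have hi2 : Integrable (fun z : PhaseSpace N => z.2 i ^ 2) ((pinnedChain ω₂ lam β γ).gibbsMeasure N T) :=
      integrable_of_abs_le_exp (pinnedChain_integrable_exp_mul_hamiltonian_gibbsMeasure hω hl hβ.le γ N hT hϑ1)
        (by fun_prop) (fun y => by
          rw [abs_of_nonneg (sq_nonneg _)]
          exact sq_momentum_le_exp (γ := γ) hω hl hβ.le hϑ0 y i)
    rw [integral_sub hi2 (integrable_const T), integral_const, integral_momentum_sq_gibbsMeasure hω hl hβ hT N i]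
    simp [probReal_univ]
  exact greenKubo_autocorr_nonneg hω hl hβ hγ hN hT hϑ0 h2ϑ (by fun_prop) (by positivity) hvb hv0

end Pinned

end Summit.AtomisticToContinuum.FouriersLaw.Theorems.IncoherentBounded

end
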